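import Summits.AnomalousDissipation.AnomalousDissipation.Theorems.SolenoidalFractalHomogenisationRealisedQuasiStaticCellLawCellSlotFormulas
import Summits.AnomalousDissipation.AnomalousDissipation.Theorems.SolenoidalFractalHomogenisationRealisedQuasiStaticCellLawCellLadder
import Summits.AnomalousDissipation.AnomalousDissipation.Theorems.SolenoidalFractalHomogenisationLagrangianStepDefs
import Literature.Analysis.FluidPDE.PassiveVectorTensorFourier
import HarnessLib

/-!
# K1L_D `LagrangianRenormalisationStepDesign` (stmt-AnomalousDissipation-27980), W7 engine sub-piece S1a / `stub_cellLawV0_IS` V0: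
# the SLOT LINKS of the flat tensor cell problem — transport Fourier coefficients of the cell carrier and the CHAIN ODE of
# every weak solution in integrated form (helper; `--supports stmt-AnomalousDissipation-27980`)

Summits-side helper file of route `SolenoidalFractalHomogenisation` (prover seat `ad-k1l-cellLawV-w1` g4; W7 engine plan of
record = planner ad-ideate-p4 g13 `Cruxes/LagrangianRenormalisationStep/Lines/onelevel-W7-threemode.md` §1/§5 S1 «fibre/chain
bookkeeping for the weak solution», planner ad-ideate-p5 g10 STATUS 21:12:07Z (c); also step V0 «sector / Fourier reduction» of
`stub_cellLawV0_IS`).  Everything proved; no definitions, no named facts, no sorry.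

For ANY lattice word `W₁` and cell number `n ≥ 1` the cell carrier `W₁.cell n` is, at every time `t`, the real trigonometric
polynomial `Σⱼ (1/n)·trapⱼ(t)·(e_{Kⱼ} aⱼ + e_{−Kⱼ} a′ⱼ)·êⱼ` (`Kⱼ i = mⱼ i · n`, `aⱼ = e^{iφⱼ}/(2·(2π|mⱼ|)·i)`, `a′ⱼ = conj aⱼ`;
K2R `complexify_layer_nsmul`, `cell_eq_layerComb`).  Hence (WEAK-SOLUTION level, no Galerkin truncation):

* §1 `ofReal_cell_coord` — the coordinates of the cell slice as two-mode sums;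
* §2 `mFourierCoeff_cell_coord_smul` — **the transport coefficients are SLOT LINKS**: for every integrable real field `v`,
  `𝓕((W₁.cell n t)_a • v)(k) = Σⱼ ((1/n)trapⱼ(t)·(êⱼ)_a) • (aⱼ • v̂(k − Kⱼ) + a′ⱼ • v̂(k + Kⱼ))` (`v̂ = 𝓕(complexify ∘ v)`;
  shift rule `𝓕(e_y • G)(k) = Ĝ(k − y)`, Boyd 2001 §4.5 Thm 19);
* §3 `transport_pairing_cell` — the transport term of the modewise identity
  (`PassiveVectorTensorFourier.ae_inner_mFourierCoeff_eq`): `Σ_a 2πi k_a ⟪𝓕((W₁.cell n t)_a • v)(k), z⟫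
   = Σⱼ 2πi (êⱼ·k)·(1/n)trapⱼ(t)·(a′ⱼ ⟪v̂(k − Kⱼ), z⟫ + aⱼ ⟪v̂(k + Kⱼ), z⟫)` (the pairing is conjugate-linear in the
  first slot and `conj aⱼ = a′ⱼ`), with the link factor `êⱼ·k` CONSTANT along each chain `k + ℤKⱼ` (`êⱼ ⊥ mⱼ`,
  `sum_e_mul_sub_cellFreq` / `sum_e_mul_add_cellFreq`) — Meshalkin–Sinai's three-term recursion, here for the Leray-projected
  vector problem and at the level of the weak solution;
* §4 `ae_inner_mFourierCoeff_eq_cell` — **THE CHAIN ODE, integrated form**: for every weak solution `u` of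
  `IsWeakTensorPassiveVectorOn 0 T 𝔹 (W₁.cell n) F u` with `F ∈ L¹`, every `k` and every transversal `z` (`k·z = 0`), for a.e.
  `t ∈ (0,T)`:  `⟪û(t)(k), z⟫ = ⟪F̂(k), z⟫ + ∫_{(0,t]} ( −4π² ⟪û(τ)(k), T_𝔹(k) z⟫
      + Σⱼ 2πi (êⱼ·k)(1/n)trapⱼ(τ)·(a′ⱼ ⟪û(τ)(k − Kⱼ), z⟫ + aⱼ ⟪û(τ)(k + Kⱼ), z⟫) ) dτ`;
  `cellField W M hM ν hν n` is `W₁.cell n` for the stretched word `W₁ = (W.stretch M).stretch (1/ν)` (`cellField_eq_cell`, `rfl`),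
  whose slots keep `m, ê, φ, ramp` and have `τ′ = Mτ/ν` (K2R `cellSlot_formulas`), so the identity IS the chain system of the
  cell problem of `ClassDecayW` / `HighLabelDecayW` / `SlowVectorClauseNoExF` (tensor `𝔹 = (1/n²)•𝔸`, `T_𝔹 = (1/n²)T_𝔸`).
The continuous (absolutely continuous) representatives of the modes, their a.e. derivatives, and the energy representative are
the business of the sequel files `…CellChainModes` / `…CellChainEnergy`.  NOT a proof of any registered stub, of the crux, or of
anomalous dissipation; rung F-D1.A0 infrastructure.
-/

set_option linter.dupNamespace false

noncomputable section

namespace Summit.AnomalousDissipation.AnomalousDissipation.Theorems.SolenoidalFractalHomogenisation.LagrangianStep.CellChain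

open Set MeasureTheory Filter Topology Function Complex UnitAddTorus
open scoped InnerProductSpace ComplexConjugate
open Literature.Analysis Literature.Analysis.FunctionSpaces Literature.Analysis.FunctionSpaces.Torus
open Literature.Analysis.FluidPDE Literature.Analysis.FluidPDE.LatticeShear
open Summit.AnomalousDissipation.AnomalousDissipation.Theorems.SolenoidalFractalHomogenisation.RealisedQuasiStaticCellLaw
open Summit.AnomalousDissipation.AnomalousDissipation.Theorems.SolenoidalFractalHomogenisation.LagrangianStep

variable {k₀ : ℕ}

/-! ## §0 Small algebra of the slot data -/

/-- The second layer amplitude is the conjugate of the first: `conj a′ⱼ = aⱼ`. [cite: MeshalkinSinai1961, pp. 1700–1705] -/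
theorem layerAmp'_conj (P : LatticePhase) :
    conj (starRingEnd ℂ (Complex.exp (P.φ * Complex.I)) *
        (-(1 / (2 * ((2 * Real.pi * ‖latticeVec P.m‖ : ℝ) : ℂ) * Complex.I)))) =
      Complex.exp (P.φ * Complex.I) * (1 / (2 * ((2 * Real.pi * ‖latticeVec P.m‖ : ℝ) : ℂ) * Complex.I)) := by
  have h := congrArg conj (layerAmp_conj P)
  rw [Complex.conj_conj] at h
  exact h.symm

/-- `êⱼ ⊥ mⱼ` in coordinates: `Σ_a êⱼ_a · (mⱼ a · n) = 0`. [folklore] -/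
theorem sum_e_mul_cellFreq (P : LatticePhase) (n : ℕ) :
    ∑ a, P.e a * (((fun i => P.m i * (n : ℤ)) a : ℤ) : ℝ) = 0 := by
  have h := P.e_perp
  rw [EuclideanSpace.inner_eq_star_dotProduct] at h
  have h' : ∑ i : Fin 3, P.e i * (P.m i : ℝ) = 0 := by
    simpa [dotProduct, latticeVec_apply, mul_comm] using h
  have h2 : ∑ a, P.e a * (((fun i => P.m i * (n : ℤ)) a : ℤ) : ℝ) = (n : ℝ) * ∑ a, P.e a * (P.m a : ℝ) := by
    rw [Finset.mul_sum]
    refine Finset.sum_congr rfl fun a _ => ?_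
    push_cast
    ring
  rw [h2, h', mul_zero]

/-- The link factor is constant along the chain (lower neighbour): `êⱼ·(k − Kⱼ) = êⱼ·k`. [cite: MeshalkinSinai1961, pp. 1700–1705] -/
theorem sum_e_mul_sub_cellFreq (P : LatticePhase) (n : ℕ) (k : Fin 3 → ℤ) :
    ∑ a, P.e a * (((k - fun i => P.m i * (n : ℤ)) a : ℤ) : ℝ) = ∑ a, P.e a * (k a : ℝ) := by
  have h := sum_e_mul_cellFreq P n
  simp only [Pi.sub_apply, Int.cast_sub, mul_sub, Finset.sum_sub_distrib]
  simp only at h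
  rw [h, sub_zero]

/-- The link factor is constant along the chain (upper neighbour): `êⱼ·(k + Kⱼ) = êⱼ·k`. [cite: MeshalkinSinai1961, pp. 1700–1705] -/
theorem sum_e_mul_add_cellFreq (P : LatticePhase) (n : ℕ) (k : Fin 3 → ℤ) :
    ∑ a, P.e a * (((k + fun i => P.m i * (n : ℤ)) a : ℤ) : ℝ) = ∑ a, P.e a * (k a : ℝ) := by
  have h := sum_e_mul_cellFreq P n
  simp only [Pi.add_apply, Int.cast_add, mul_add, Finset.sum_add_distrib]
  simp only at h
  rw [h, add_zero]

/-! ## §1 The coordinates of the cell slice -/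

/-- **The complexified cell slice, layer by layer**: `complexify (W₁.cell n t x) = Σⱼ ((1/n)trapⱼ(t)) • ((e_{Kⱼ}(x) aⱼ + e_{−Kⱼ}(x) a′ⱼ) • complexify êⱼ)`.
[cite: MeshalkinSinai1961, pp. 1700–1705] -/
theorem complexify_cell_apply (W₁ : LatticeWord k₀) (n : ℕ) (t : ℝ) (x : UnitAddTorus (Fin 3)) :
    EuclideanSpace.complexify (W₁.cell n t x) =
      ∑ j, (((1 / (n : ℝ)) * LatticeWord.trapezoid (W₁.start j) (W₁.phase j).τ W₁.ramp
          (Int.fract (t / W₁.period) * W₁.period) : ℝ) : ℂ) •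
        ((mFourier (fun i => (W₁.phase j).m i * n) x *
            (Complex.exp ((W₁.phase j).φ * Complex.I) * (1 / (2 * ((2 * Real.pi * ‖latticeVec (W₁.phase j).m‖ : ℝ) : ℂ) * Complex.I))) +
          mFourier (-fun i => (W₁.phase j).m i * n) x *
            (starRingEnd ℂ (Complex.exp ((W₁.phase j).φ * Complex.I)) *
              (-(1 / (2 * ((2 * Real.pi * ‖latticeVec (W₁.phase j).m‖ : ℝ) : ℂ) * Complex.I))))) •
          EuclideanSpace.complexify (W₁.phase j).e) := by
  rw [cell_eq_layerComb]
  simp only [map_sum]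
  refine Finset.sum_congr rfl fun j _ => ?_
  rw [LinearIsometry.map_smul, complexify_layer_nsmul, Complex.coe_smul]

/-- **Coordinates of the cell slice** (real, cast to `ℂ`): `(W₁.cell n t x)_a = Σⱼ (1/n)trapⱼ(t)·(e_{Kⱼ}(x) aⱼ + e_{−Kⱼ}(x) a′ⱼ)·(êⱼ)_a`.
[cite: MeshalkinSinai1961, pp. 1700–1705] -/
theorem ofReal_cell_coord (W₁ : LatticeWord k₀) (n : ℕ) (t : ℝ) (x : UnitAddTorus (Fin 3)) (a : Fin 3) :
    (((W₁.cell n t x) a : ℝ) : ℂ) =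
      ∑ j, (((1 / (n : ℝ)) * LatticeWord.trapezoid (W₁.start j) (W₁.phase j).τ W₁.ramp
          (Int.fract (t / W₁.period) * W₁.period) : ℝ) : ℂ) *
        ((mFourier (fun i => (W₁.phase j).m i * n) x *
            (Complex.exp ((W₁.phase j).φ * Complex.I) * (1 / (2 * ((2 * Real.pi * ‖latticeVec (W₁.phase j).m‖ : ℝ) : ℂ) * Complex.I))) +
          mFourier (-fun i => (W₁.phase j).m i * n) x *
            (starRingEnd ℂ (Complex.exp ((W₁.phase j).φ * Complex.I)) *
              (-(1 / (2 * ((2 * Real.pi * ‖latticeVec (W₁.phase j).m‖ : ℝ) : ℂ) * Complex.I))))) *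
          ((W₁.phase j).e a : ℂ)) := by
  rw [← EuclideanSpace.complexify_apply, complexify_cell_apply]
  simp only [WithLp.ofLp_sum, Finset.sum_apply, WithLp.ofLp_smul, Pi.smul_apply, smul_eq_mul,
    EuclideanSpace.complexify_apply]


/-! ## §2 The transport coefficients of the cell carrier are slot links -/

/-- Shift rule, vector-valued: `𝓕(e_y • G)(k) = Ĝ(k − y)` (private twin of
`TorusLpOperatorFactsCommutatorProofs.mFourierCoeff_mFourier_smul`, not imported here). [folklore] -/
private theorem mFourierCoeff_mFourier_smul' {E : Type*} [NormedAddCommGroup E] [NormedSpace ℂ E]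
    (G : UnitAddTorus (Fin 3) → E) (y k : Fin 3 → ℤ) :
    mFourierCoeff (fun x => mFourier y x • G x) k = mFourierCoeff G (k - y) := by
  unfold mFourierCoeff
  congr 1
  funext x
  rw [smul_smul, ← mFourier_add]
  congr 2
  abel

/-- A character times an integrable field is integrable. [folklore] -/
theorem integrable_mFourier_smul_of_integrable {E : Type*} [NormedAddCommGroup E] [NormedSpace ℂ E]
    {G : UnitAddTorus (Fin 3) → E} (hG : Integrable G volume) (y : Fin 3 → ℤ) :
    Integrable (fun x => mFourier y x • G x) volume :=
  hG.bdd_smul 1 (mFourier y).continuous.aestronglyMeasurable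
    (Eventually.of_forall fun x => ((mFourier y).norm_coe_le_norm x).trans_eq mFourier_norm)

/-- **The transport coefficients along the cell carrier are SLOT LINKS.**  For every integrable real field `v` on `𝕋³`,
every coordinate `a`, every frequency `k`:
`𝓕(complexify ∘ ((W₁.cell n t)_a • v))(k) = Σⱼ ((1/n)trapⱼ(t)·(êⱼ)_a) • (aⱼ • v̂(k − Kⱼ) + a′ⱼ • v̂(k + Kⱼ))`,
`v̂ = 𝓕(complexify ∘ v)`, `Kⱼ i = mⱼ i · n` (product with a band-limited carrier ↔ shifted coefficients).
[cite: Boyd2001, §4.5 Theorem 19 (4.44)] [cite: MeshalkinSinai1961, pp. 1700–1705] -/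
theorem mFourierCoeff_cell_coord_smul (W₁ : LatticeWord k₀) (n : ℕ) (t : ℝ) (a : Fin 3)
    {v : UnitAddTorus (Fin 3) → EuclideanSpace ℝ (Fin 3)} (hv : Integrable v volume) (k : Fin 3 → ℤ) :
    mFourierCoeff (EuclideanSpace.complexify ∘ fun x => (W₁.cell n t x) a • v x) k =
      ∑ j, ((((1 / (n : ℝ)) * LatticeWord.trapezoid (W₁.start j) (W₁.phase j).τ W₁.ramp
          (Int.fract (t / W₁.period) * W₁.period)) * (W₁.phase j).e a : ℝ) : ℂ) •
        ((Complex.exp ((W₁.phase j).φ * Complex.I) * (1 / (2 * ((2 * Real.pi * ‖latticeVec (W₁.phase j).m‖ : ℝ) : ℂ) * Complex.I))) •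
            mFourierCoeff (EuclideanSpace.complexify ∘ v) (k - fun i => (W₁.phase j).m i * n) +
          (starRingEnd ℂ (Complex.exp ((W₁.phase j).φ * Complex.I)) *
              (-(1 / (2 * ((2 * Real.pi * ‖latticeVec (W₁.phase j).m‖ : ℝ) : ℂ) * Complex.I)))) •
            mFourierCoeff (EuclideanSpace.complexify ∘ v) (k + fun i => (W₁.phase j).m i * n)) := by
  set G : UnitAddTorus (Fin 3) → EuclideanSpace ℂ (Fin 3) := EuclideanSpace.complexify ∘ v with hG
  have hGi : Integrable G volume := (EuclideanSpace.complexify (ι := Fin 3)).toContinuousLinearMap.integrable_comp hv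
  have hint : ∀ y : Fin 3 → ℤ, Integrable (fun x => mFourier y x • G x) volume := fun y =>
    integrable_mFourier_smul_of_integrable hGi y
  -- the product, layer by layer, as a combination of character-shifted copies of `G`
  have hfun : (EuclideanSpace.complexify ∘ fun x => (W₁.cell n t x) a • v x) =
      fun x => ∑ j,
        ((((((1 / (n : ℝ)) * LatticeWord.trapezoid (W₁.start j) (W₁.phase j).τ W₁.ramp (Int.fract (t / W₁.period) * W₁.period)) * (W₁.phase j).e a : ℝ) : ℂ) * (Complex.exp ((W₁.phase j).φ * Complex.I) * (1 / (2 * ((2 * Real.pi * ‖latticeVec (W₁.phase j).m‖ : ℝ) : ℂ) * Complex.I)))) •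
            (fun y => mFourier (fun i => (W₁.phase j).m i * n) y • G y) +
          (((((1 / (n : ℝ)) * LatticeWord.trapezoid (W₁.start j) (W₁.phase j).τ W₁.ramp (Int.fract (t / W₁.period) * W₁.period)) * (W₁.phase j).e a : ℝ) : ℂ) *
              (starRingEnd ℂ (Complex.exp ((W₁.phase j).φ * Complex.I)) * (-(1 / (2 * ((2 * Real.pi * ‖latticeVec (W₁.phase j).m‖ : ℝ) : ℂ) * Complex.I))))) •
            (fun y => mFourier (-fun i => (W₁.phase j).m i * n) y • G y)) x := by
    funext x
    simp only [Function.comp_apply, Pi.add_apply, Pi.smul_apply]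
    rw [LinearIsometry.map_smul, ← Complex.coe_smul, ofReal_cell_coord, Finset.sum_smul]
    refine Finset.sum_congr rfl fun j _ => ?_
    rw [smul_smul, smul_smul, ← add_smul]
    congr 1
    push_cast
    ring
  rw [hfun, Torus.mFourierCoeff_finset_sum _ (fun j _ => ((hint _).smul _).add ((hint _).smul _))]
  refine Finset.sum_congr rfl fun j _ => ?_
  rw [mFourierCoeff_add ((hint _).smul _) ((hint _).smul _), mFourierCoeff_const_smul, mFourierCoeff_const_smul,
    mFourierCoeff_mFourier_smul', mFourierCoeff_mFourier_smul', sub_neg_eq_add, smul_add, smul_smul, smul_smul]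

/-! ## §3 The transport term of the modewise identity -/

/-- **The transport pairing along the cell carrier** (the `Σ_a 2πi k_a ⟪𝓕(b_a v)(k), z⟫` term of
`PassiveVectorTensorFourier.ae_inner_mFourierCoeff_eq` with `b = W₁.cell n t`):
`Σ_a 2πi k_a ⟪𝓕((W₁.cell n t)_a • v)(k), z⟫ = Σⱼ 2πi (êⱼ·k)·(1/n)trapⱼ(t)·(a′ⱼ ⟪v̂(k − Kⱼ), z⟫ + aⱼ ⟪v̂(k + Kⱼ), z⟫)`
(the pairing is conjugate-linear in its first slot and `conj aⱼ = a′ⱼ`, `conj a′ⱼ = aⱼ`). [cite: MeshalkinSinai1961, pp. 1700–1705] -/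
theorem transport_pairing_cell (W₁ : LatticeWord k₀) (n : ℕ) (t : ℝ)
    {v : UnitAddTorus (Fin 3) → EuclideanSpace ℝ (Fin 3)} (hv : Integrable v volume) (k : Fin 3 → ℤ)
    (z : EuclideanSpace ℂ (Fin 3)) :
    ∑ a, (2 * Real.pi * Complex.I * (k a)) *
        ⟪mFourierCoeff (EuclideanSpace.complexify ∘ fun x => (W₁.cell n t x) a • v x) k, z⟫_ℂ =
      ∑ j, (2 * Real.pi * Complex.I * (∑ a, ((W₁.phase j).e a : ℂ) * (k a))) *
        (((1 / (n : ℝ)) * LatticeWord.trapezoid (W₁.start j) (W₁.phase j).τ W₁.ramp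
          (Int.fract (t / W₁.period) * W₁.period) : ℝ) : ℂ) *
        ((starRingEnd ℂ (Complex.exp ((W₁.phase j).φ * Complex.I)) *
              (-(1 / (2 * ((2 * Real.pi * ‖latticeVec (W₁.phase j).m‖ : ℝ) : ℂ) * Complex.I)))) *
            ⟪mFourierCoeff (EuclideanSpace.complexify ∘ v) (k - fun i => (W₁.phase j).m i * n), z⟫_ℂ +
          (Complex.exp ((W₁.phase j).φ * Complex.I) * (1 / (2 * ((2 * Real.pi * ‖latticeVec (W₁.phase j).m‖ : ℝ) : ℂ) * Complex.I))) *
            ⟪mFourierCoeff (EuclideanSpace.complexify ∘ v) (k + fun i => (W₁.phase j).m i * n), z⟫_ℂ) := by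
  have step : ∀ a, (2 * Real.pi * Complex.I * (k a)) *
      ⟪mFourierCoeff (EuclideanSpace.complexify ∘ fun x => (W₁.cell n t x) a • v x) k, z⟫_ℂ =
      ∑ j, (2 * Real.pi * Complex.I * (k a)) *
        ((((1 / (n : ℝ)) * LatticeWord.trapezoid (W₁.start j) (W₁.phase j).τ W₁.ramp
          (Int.fract (t / W₁.period) * W₁.period)) * (W₁.phase j).e a : ℝ) : ℂ) *
        ((starRingEnd ℂ (Complex.exp ((W₁.phase j).φ * Complex.I)) *
              (-(1 / (2 * ((2 * Real.pi * ‖latticeVec (W₁.phase j).m‖ : ℝ) : ℂ) * Complex.I)))) *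
            ⟪mFourierCoeff (EuclideanSpace.complexify ∘ v) (k - fun i => (W₁.phase j).m i * n), z⟫_ℂ +
          (Complex.exp ((W₁.phase j).φ * Complex.I) * (1 / (2 * ((2 * Real.pi * ‖latticeVec (W₁.phase j).m‖ : ℝ) : ℂ) * Complex.I))) *
            ⟪mFourierCoeff (EuclideanSpace.complexify ∘ v) (k + fun i => (W₁.phase j).m i * n), z⟫_ℂ) := by
    intro a
    rw [mFourierCoeff_cell_coord_smul W₁ n t a hv k, sum_inner, Finset.mul_sum]
    refine Finset.sum_congr rfl fun j _ => ?_
    rw [inner_smul_left, inner_add_left, inner_smul_left, inner_smul_left, Complex.conj_ofReal, layerAmp_conj,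
      layerAmp'_conj]
    ring
  simp_rw [step]
  rw [Finset.sum_comm]
  refine Finset.sum_congr rfl fun j _ => ?_
  rw [Finset.mul_sum, Finset.sum_mul, Finset.sum_mul]
  refine Finset.sum_congr rfl fun a _ => ?_
  push_cast
  ring

/-! ## §4 The chain ODE of a weak solution, integrated form -/

/-- **THE CHAIN ODE (integrated form) of every weak solution of the flat tensor cell problem.**  Let `u` be a weak solution
of `∂ₜu + (b·∇)u + ∇π = 𝓛_𝔹 u`, `∇·u = 0`, along the cell carrier `b = W₁.cell n` of a lattice word, from an integrable datum
`F`.  For every frequency `k` and every transversal `z ∈ ℂ³` (`k·z = 0`), for a.e. `t ∈ (0,T)`: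
`⟪û(t)(k), z⟫ = ⟪F̂(k), z⟫ + ∫_{(0,t]} ( −4π² ⟪û(τ)(k), T_𝔹(k) z⟫
   + Σⱼ 2πi (êⱼ·k)·(1/n)trapⱼ(τ)·(a′ⱼ ⟪û(τ)(k − Kⱼ), z⟫ + aⱼ ⟪û(τ)(k + Kⱼ), z⟫) ) dτ`
— mode `k` is driven only by its two chain neighbours `k ∓ Kⱼ` of the slot(s) active at time `τ`, through the link factor
`êⱼ·k` (constant along the chain).  (`PassiveVectorTensorFourier.ae_inner_mFourierCoeff_eq` + `transport_pairing_cell`.)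
[cite: MeshalkinSinai1961, pp. 1700–1705] [cite: Frisch1995Turbulence, §9.6.3 eq. (9.57) p. 233] -/
theorem ae_inner_mFourierCoeff_eq_cell (W₁ : LatticeWord k₀) (n : ℕ) {T : ℝ} {𝔹 : Torus.Visc4 (Fin 3)}
    {F : UnitAddTorus (Fin 3) → EuclideanSpace ℝ (Fin 3)} {u : ℝ → UnitAddTorus (Fin 3) → EuclideanSpace ℝ (Fin 3)}
    (h : Torus.IsWeakTensorPassiveVectorOn 0 T 𝔹 (W₁.cell n) F u) (hF : Integrable F volume)
    (k : Fin 3 → ℤ) {z : EuclideanSpace ℂ (Fin 3)} (hz : ∑ j, (k j : ℂ) * z j = 0) :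
    ∀ᵐ t ∂(volume.restrict (Ioo 0 T)),
      ⟪mFourierCoeff (EuclideanSpace.complexify ∘ u t) k, z⟫_ℂ =
        ⟪mFourierCoeff (EuclideanSpace.complexify ∘ F) k, z⟫_ℂ +
        ∫ τ in Ioc 0 t,
          ((-(4 * Real.pi ^ 2 : ℝ) : ℂ) * ⟪mFourierCoeff (EuclideanSpace.complexify ∘ u τ) k, Torus.symbT 𝔹 k z⟫_ℂ +
            ∑ j, (2 * Real.pi * Complex.I * (∑ a, ((W₁.phase j).e a : ℂ) * (k a))) *
              (((1 / (n : ℝ)) * LatticeWord.trapezoid (W₁.start j) (W₁.phase j).τ W₁.ramp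
                (Int.fract (τ / W₁.period) * W₁.period) : ℝ) : ℂ) *
              ((starRingEnd ℂ (Complex.exp ((W₁.phase j).φ * Complex.I)) *
                    (-(1 / (2 * ((2 * Real.pi * ‖latticeVec (W₁.phase j).m‖ : ℝ) : ℂ) * Complex.I)))) *
                  ⟪mFourierCoeff (EuclideanSpace.complexify ∘ u τ) (k - fun i => (W₁.phase j).m i * n), z⟫_ℂ +
                (Complex.exp ((W₁.phase j).φ * Complex.I) *
                    (1 / (2 * ((2 * Real.pi * ‖latticeVec (W₁.phase j).m‖ : ℝ) : ℂ) * Complex.I))) *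
                  ⟪mFourierCoeff (EuclideanSpace.complexify ∘ u τ) (k + fun i => (W₁.phase j).m i * n), z⟫_ℂ)) := by
  have h1 := h.ae_inner_mFourierCoeff_eq hF k hz
  have hsl' : ∀ᵐ τ ∂(volume : Measure ℝ), τ ∈ Ioo 0 T → Integrable (u τ) volume :=
    (ae_restrict_iff' measurableSet_Ioo).1 (h.ae_integrable_slice.mono fun τ hτ => hτ.1)
  filter_upwards [h1, ae_restrict_mem measurableSet_Ioo] with t ht htT
  rw [ht]
  congr 1
  refine setIntegral_congr_ae measurableSet_Ioc ?_
  filter_upwards [hsl'] with τ hτ hτI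
  have hτ' : τ ∈ Ioo 0 T := ⟨hτI.1, lt_of_le_of_lt hτI.2 htT.2⟩
  rw [transport_pairing_cell W₁ n τ (hτ hτ') k z, Complex.ofReal_zero, zero_mul, add_zero]

/-! ## §5 The cell field of `ClassDecayW` / `HighLabelDecayW` / `SlowVectorClauseNoExF` is such a cell carrier -/

/-- `cellField W M hM ν hν n` IS the cell carrier of the stretched word `(W.stretch M).stretch (1/ν)` (definitional). [folklore] -/
theorem cellField_eq_cell (W : LatticeWord k₀) (M : ℝ) (hM : 0 < M) (ν : ℝ) (hν : 0 < ν) (n : ℕ) :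
    cellField W M hM ν hν n = ((W.stretch M hM).stretch (1 / ν) (one_div_pos.mpr hν)).cell n := rfl

/-- Start times of the stretched word: `start′ⱼ = (M/ν)·startⱼ` (with `cellSlot_formulas`: the stretched slots keep `m, ê, φ, ramp`
and have `τ′ = Mτ/ν`, `period′ = M·period/ν`). [folklore] -/
theorem start_stretch_stretch (W : LatticeWord k₀) {M ν : ℝ} (hM : 0 < M) (hν : 0 < ν) (j : Fin k₀) :
    ((W.stretch M hM).stretch (1 / ν) (one_div_pos.mpr hν)).start j = M * W.start j / ν := by
  unfold LatticeWord.start LatticeWord.stretch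
  simp only
  rw [Finset.mul_sum, Finset.sum_div]
  exact Finset.sum_congr rfl fun i _ => by ring

end Summit.AnomalousDissipation.AnomalousDissipation.Theorems.SolenoidalFractalHomogenisation.LagrangianStep.CellChain

end
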